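import Mathlib.Combinatorics.SimpleGraph.Walk.Counting
import Mathlib.Combinatorics.SimpleGraph.Paths
import Mathlib.Combinatorics.SimpleGraph.DeleteEdges
import Summits.CriticalPhenomena.SAWScalingLimit.Theorems.SAWTotalPositivityBoundaryTP2Defs
import HarnessLib

/-!
# Crux `BoundaryTP2` (stmt-CriticalPhenomena-7115), line `Sketch`: interlacing is inherited by corner deletion

Hypothesis (i) of the crux is `Interlaced H p₁ p₂ p₃ p₄`: every self-avoiding path `p₁ → p₃` of `H` shares a
vertex with every self-avoiding path `p₂ → p₄`. The corner-deletion induction deletes the corner `p₃`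
(vertex deletion written as Mathlib's `H.deleteEdges (H.incidenceSet p₃)`: same vertex type, `p₃` isolated)
and needs (i) for the quadruple `(p₁, p₂, u, p₄)` in `H − p₃` for each neighbour `u` of `p₃`. This file proves
exactly that (`stub_interlaced_deleteVert`): a path `p₁ → u` of `H − p₃` avoids `p₃`, so extending it by the
edge `u p₃` gives a self-avoiding path `p₁ → p₃` of `H`; interlacing in `H` produces a common vertex with any
path `p₂ → p₄` of `H − p₃` (viewed in `H`), and that vertex is not `p₃` because the second path avoids `p₃`.
-/

noncomputable section

namespace Summit.CriticalPhenomena.SAWScalingLimit.Theorems.BoundaryTP2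

open scoped ENNReal

variable {V : Type*}

/-- In `H.deleteEdges (H.incidenceSet c)` the vertex `c` is isolated: both endpoints of an edge differ
from `c`. [folklore] -/
theorem ne_of_adj_deleteEdges_incidenceSet {H : SimpleGraph V} {c v w : V}
    (h : (H.deleteEdges (H.incidenceSet c)).Adj v w) : v ≠ c ∧ w ≠ c := by
  rw [SimpleGraph.deleteEdges_adj, SimpleGraph.mk'_mem_incidenceSet_iff] at h
  obtain ⟨hvw, hn⟩ := h
  refine ⟨?_, ?_⟩
  · rintro rfl
    exact hn ⟨hvw, Or.inl rfl⟩
  · rintro rfl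
    exact hn ⟨hvw, Or.inr rfl⟩

/-- A walk of `H.deleteEdges (H.incidenceSet c)` between two vertices different from `c` never visits the
isolated vertex `c`. [folklore] -/
theorem notMem_support_of_walk_deleteEdges_incidenceSet {H : SimpleGraph V} {c a b : V}
    (W : (H.deleteEdges (H.incidenceSet c)).Walk a b) (ha : a ≠ c) (hb : b ≠ c) : c ∉ W.support := by
  induction W with
  | nil =>
    rw [SimpleGraph.Walk.support_nil, List.mem_singleton]
    exact fun h => hb h.symm
  | cons h q ih =>
    rw [SimpleGraph.Walk.support_cons, List.mem_cons, not_or]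
    exact ⟨fun h' => ha h'.symm, ih (ne_of_adj_deleteEdges_incidenceSet h).2 hb⟩

/-- **Interlacing is inherited by corner deletion.** If every self-avoiding path `p₁ → p₃` of `H` meets every
self-avoiding path `p₂ → p₄`, `u` is a neighbour of `p₃`, and `p₃ ∉ {p₁, p₂, p₄}`, then in the graph
`H − p₃ = H.deleteEdges (H.incidenceSet p₃)` every self-avoiding path `p₁ → u` meets every self-avoiding path
`p₂ → p₄`: extend the first path by the edge `u p₃` (it avoids the isolated vertex `p₃`, so the extension is
still self-avoiding), apply interlacing in `H`, and note that the common vertex is not `p₃` since the second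
path avoids `p₃` as well. [folklore] -/
theorem stub_interlaced_deleteVert (H : SimpleGraph V) (p₁ p₂ p₃ p₄ u : V)
    (hI : Interlaced H p₁ p₂ p₃ p₄) (hu : H.Adj u p₃) (h₁ : p₃ ≠ p₁) (h₂ : p₃ ≠ p₂) (h₄ : p₃ ≠ p₄) :
    Interlaced (H.deleteEdges (H.incidenceSet p₃)) p₁ p₂ u p₄ := by
  intro P Q
  have hle : H.deleteEdges (H.incidenceSet p₃) ≤ H := SimpleGraph.deleteEdges_le _
  have hP₃ : p₃ ∉ P.1.support := notMem_support_of_walk_deleteEdges_incidenceSet P.1 h₁.symm hu.ne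
  have hQ₃ : p₃ ∉ Q.1.support := notMem_support_of_walk_deleteEdges_incidenceSet Q.1 h₂.symm h₄.symm
  have hP' : ((P.1.mapLe hle).concat hu).IsPath :=
    (SimpleGraph.Walk.IsPath.mapLe hle P.2).concat
      (by rwa [SimpleGraph.Walk.support_mapLe_eq_support]) hu
  obtain ⟨v, hvP, hvQ⟩ := hI ⟨_, hP'⟩ ⟨Q.1.mapLe hle, SimpleGraph.Walk.IsPath.mapLe hle Q.2⟩
  rw [SimpleGraph.Walk.support_concat, SimpleGraph.Walk.support_mapLe_eq_support, List.mem_append,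
    List.mem_singleton] at hvP
  rw [SimpleGraph.Walk.support_mapLe_eq_support] at hvQ
  rcases hvP with hvP | rfl
  · exact ⟨v, hvP, hvQ⟩
  · exact absurd hvQ hQ₃

end Summit.CriticalPhenomena.SAWScalingLimit.Theorems.BoundaryTP2
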